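import Summits.QuantumFields.QCD.Theses.SmallBetaInfraredSplit

/-!
# Route `SmallBetaInfraredSplit` (QCD sub), LINE 11 (ym-idea-2 g9): glue `NeighbourFloorOfAPriori` (stmt-QuantumFields-23831)

`NeighbourFloorOfAPriori := BlockAPrioriBound → FloorFromAPriori → NeighbourFloorSmallBeta` with
`FloorFromAPriori := BlockAPrioriBound → NeighbourFloorSmallBeta`: modus ponens.  The mathematical content of LINE 11 lives in
`BlockAPrioriBound` (stmt-QuantumFields-23829) and `FloorFromAPriori` (stmt-QuantumFields-23830), both OPEN.  Cell `ym-idea-1` width seat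
`ym-line-sfw-p2-w3` g31 (free hands).  HONEST SCOPE: pure logic; no crux, rung or summit is proved; nothing here bears on the Yang–Mills
mass gap or on QCD.
-/

namespace Summit.QuantumFields.QCD.Theorems.SmallBetaInfraredSplit

/-- **Glue `NeighbourFloorOfAPriori`** (stmt-QuantumFields-23831): modus ponens. [folklore] -/
theorem neighbourFloorOfAPriori_proof : Summit.QuantumFields.QCD.Theses.SmallBetaInfraredSplit.NeighbourFloorOfAPriori :=
  fun hA hF => hF hA

end Summit.QuantumFields.QCD.Theorems.SmallBetaInfraredSplit
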